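import Literature.Topology.FourManifolds.HomotopySpheresBPCyclicFrontier
import Literature.Topology.FourManifolds.HomotopySpheresBPOrderSignatureUnimodular
import Literature.Topology.FourManifolds.LatticeFormsKervaireMilnorBasis
import Literature.Topology.FourManifolds.ClosedModelRelOrientation
import HarnessLib

/-!
# Kervaire–Milnor's Thm. 7.5 reduced to Lemma 7.1: the algebra of Lemma 7.3 discharged

Topic `Literature/Topology/FourManifolds`; fourth pure-proof sibling (after
`HomotopySpheresSignatureProofs.lean`, `HomotopySpheresSignatureReduction.lean` and
`HomotopySpheresSignatureKilling.lean`) of the named fact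
`Literature.Topology.FourManifolds.HomotopySphere.mk_eq_mk_iff_sigmaGen_dvd_sub`: M. Kervaire,
J. Milnor, *Groups of homotopy spheres I*, Ann. of Math. 77 (1963), **Thm. 7.5** (pp. 529–530).
Everything here is **proved**; no definition, no named fact and no statement is added or changed
(D-0026, net debt `0`).

`HomotopySpheresSignatureKilling.lean` left Thm. 7.5 as the one-line consequence
(`mk_eq_mk_iff_sigmaGen_dvd_sub_of_killMiddleHomology`) of four inputs: (`hkill`) the surgical
content of Lemma 7.3 for `(2m-1)`-connected `M` — "`H₂ₘM` can be killed"; Kosinski's X.2.2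
(`exists_highlyConnected_of_mem_signatureSet`); Smale's h-cobordism theorem; §2-additivity — the
last now DISCHARGED (`add_mem_signatureSet_of_isOrientedConnectedSum_holds`). Kervaire–Milnor's
proof of Lemma 7.3 for `(k-1)`-connected `M`, `k = 2m` (p. 529), has three moves:

1. "Since the quadratic form `λ → λ·λ` has determinant `±1` and signature zero, it is possible
   to choose a basis `{λ₁, …, λᵣ, μ₁, …, μᵣ}` for `HₖM` so that `λᵢ·λⱼ = 0`, `λᵢ·μⱼ = δᵢⱼ`"
   — determinant `±1` is the Poincaré duality of p. 528 (with the footnote pp. 528–529: adjoin a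
   cone over the boundary), the basis is [17, Lemma 9];
2. "For any imbedded sphere with homology class `λ = n₁λ₁ + … + nᵣλᵣ`, the self-intersection
   number `λ·λ` is zero. Therefore, according to [17, Lemma 7], the normal bundle is trivial.
   Thus `M` satisfies the hypothesis of 7.1";
3. "It follows that `HₖM` can be killed by spherical modifications" — Lemma 7.1 (pp. 526–528:
   represent `λᵣ` by an embedded sphere, [17, Lemma 6] / Haefliger; surgery; the diagram of
   Lemma 5.6; iterate `r` times), framed by Lemma 6.2 since `πₖ(SOₖ₊₁) → πₖ(SO)` is onto for
   `k` even; and then Thm. 6.6 (`bM₁ = bM`, `M₁` `k`-connected, hence contractible).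

Move 1 is now a theorem of the tree: the duality is
`HomotopySphere.isUnimodular_intersectionForm_closedModel` (Kervaire–Milnor p. 528 with the
footnote; `HomotopySpheresBPOrderSignatureUnimodular.lean`) and the basis is
`LinearMap.BilinForm.exists_basis_isotropic_dual` (`LatticeFormsKervaireMilnorBasis.lean`, from
Serre's Theorem 3, proved in the tree via Meyer and Hasse–Minkowski). This file therefore
**discharges move 1** and restates Thm. 7.5 over moves 2–3 only — Kervaire–Milnor's Lemma 7.1
together with [17, Lemma 7] and the last clause of Thm. 6.6, i.e. the purely surgical step —
in the binder shape in which Kosinski's X.2.2 delivers the data (`hconn` produces a homological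
orientation `μ` of `Σ` compatible with its smooth orientation, a `(2m-1)`-connected
s-parallelizable null-cobordism `c` and an orientation `μ'` of the closed model `M̂ = M ∪ cone(bM)`
WITH `(Σ, μ) = bM`, `c.IsOrientedBy μ μ'`). Keeping `c.IsOrientedBy μ μ'` among the hypotheses
(it was discarded in `…_of_highlyConnected` / `hkill`) is what makes move 1 available: it gives
`[M̂]` as a genuine fundamental class (`NullCobordism.IsOrientedBy.isFundamentalClass_fundamentalClass`),
hence Lefschetz duality and unimodularity; for an orientation without fundamental class the
form and `σ` would vanish for junk reasons.

* `HomotopySphere.exists_basis_isotropic_dual_intersectionForm_closedModel` — **move 1**: for a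
  homotopy `n`-sphere `Σ`, a null-cobordism `c`, orientations with `c.IsOrientedBy μ μ'`, and an
  even middle degree `p ≥ 3`, `p + p = n + 1`, with `σ(M) = μ'.signatureInDim = 0`, the
  intersection form `Q(a, b) = ⟨a ⌣ b, [M̂]⟩` on `Hᵖ(M̂; ℤ)/T` has a Kervaire–Milnor basis
  `b : Fin r ⊕ Fin r` (`rank = 2r`, `Q λᵢ λⱼ = 0`, `Q λᵢ μⱼ = δᵢⱼ`).
* `HomotopySphere.boundsContractible_of_zero_mem_signatureSet_of_lemma71` — Lemma 7.3 as invoked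
  on p. 530 (`0 ∈ signatureSet ⟹` bounds contractible) from (`h71`) **Lemma 7.1 with [17, Lemma 7]
  and Thm. 6.6 for s-parallelizable `(2m-1)`-connected null-cobordisms whose closed-model form
  has a Kervaire–Milnor basis**, and (`hconn`) X.2.2.
* `HomotopySphere.mk_eq_mk_iff_sigmaGen_dvd_sub_of_lemma71` — **Thm. 7.5 from `h71`, `hconn` and
  Smale's h-cobordism theorem** (§2-additivity discharged).
* `HomotopySphereClass.isCyclic_bP_four_mul_of_lemma71` — Cor. 7.6 (`bP₄ₘ` finite cyclic) over the
  same frontier plus Lemma 7.4 for `m > 1`, for the parked seat of `isCyclic_bP_four_mul`.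
* `exists_commGroup_homotopySphereClass_isCyclic_seven_of_lemma71` — the cone target `Θ₇` cyclic
  over the same frontier at `n = 7` (plus Lemma 3.4 "⇒" and `Θ₇ = bP₈`).

So the printed results separating the tree from `mk_eq_mk_iff_sigmaGen_dvd_sub_holds` are now
exactly: Lemma 7.1 + [17, Lemma 7] (embedded middle-dimensional spheres with trivial normal
bundle and the homology of one surgery on them, pp. 526–528), Kosinski X.2.2 (surgery below the
middle dimension) and the h-cobordism theorem.

## References

* M. Kervaire, J. Milnor, *Groups of homotopy spheres I*, Ann. of Math. 77 (1963), 504–537: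
  Lemma 7.1 (pp. 526–528), p. 528 with footnote pp. 528–529, Lemma 7.3 and its proof (p. 529),
  Thm. 6.6 (p. 526), Thm. 7.5 (pp. 529–530), Cor. 7.6 (p. 530). doi:10.2307/1970128
  [KervaireMilnorAnnals1963]
* J. Milnor, *A procedure for killing the homotopy groups of differentiable manifolds*, Proc.
  Sympos. Pure Math. III, AMS (1961), 39–55, Lemmas 6, 7, 9. [MilnorKilling1961]
* A. Kosinski, *Differential Manifolds* (1993), Ch. X, Thm. (2.2), Prop. (3.3), Thm. (3.4),
  Cor. (3.6). [Kosinski1993]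
* J. Milnor, *Lectures on the h-cobordism theorem* (1965), Thm. 9.1. [MilnorHCobordism1965]
* J.-P. Serre, *A Course in Arithmetic* (1973), Ch. V §2.2 Thm. 3. [Serre1973]
-/

open scoped Manifold ContDiff Topology
open Set Function
open Literature.AlgebraicTopology.SingularHomology

noncomputable section

namespace Literature.Topology.FourManifolds

namespace HomotopySphere

variable {n : ℕ}

/-! ### Move 1: the Kervaire–Milnor basis of `Hᵖ(M̂; ℤ)/T` when `σ(M) = 0` -/

/-- **Kervaire–Milnor 1963, proof of Lemma 7.3, first move (p. 529 with p. 528 and the footnote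
pp. 528–529).** Let `Σ` be a homotopy `n`-sphere, `c` a null-cobordism (`M = c.W`), `μ`, `μ'`
homological orientations of `Σ` and of the closed model `M̂ = M ∪ cone(bM)` with `(Σ, μ) = bM`
(`c.IsOrientedBy μ μ'`), and `p ≥ 3` even with `p + p = n + 1`. If `σ(M) = 0`
(`μ'.signatureInDim = 0`) then the intersection form `Q(a, b) = ⟨a ⌣ b, [M̂]⟩` on `Hᵖ(M̂; ℤ)/T`
— "the intersection number pairing `HₖM ⊗ HₖM → Z`", which "has determinant `±1`" by Poincaré
duality on the closed homology manifold `M̂` (`isUnimodular_intersectionForm_closedModel`) and is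
symmetric for `p` even — admits a basis `{λ₁, …, λᵣ, μ₁, …, μᵣ}` with `rank = 2r`,
`Q λᵢ λⱼ = 0`, `Q λᵢ μⱼ = δᵢⱼ` ("it is possible to choose a basis … so that `λᵢ·λⱼ = 0`,
`λᵢ·μⱼ = δᵢⱼ`", [17, Lemma 9]; tree theorem `LinearMap.BilinForm.exists_basis_isotropic_dual`).
The oriented-boundary relation supplies the fundamental class of `M̂`
(`NullCobordism.IsOrientedBy.isFundamentalClass_fundamentalClass`).
[cite: KervaireMilnorAnnals1963, proof of Lemma 7.3 (p. 529), with p. 528 and footnote pp. 528–529] [cite: MilnorKilling1961, Lemma 9] -/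
theorem exists_basis_isotropic_dual_intersectionForm_closedModel (S : HomotopySphere n)
    (c : NullCobordism n S.carrier) {μ : HomologicalOrientation ℤ S.carrier n}
    {μ' : HomologicalOrientation ℤ (ClosedModel n c.W) (n + 1)} (hob : c.IsOrientedBy μ μ')
    {p : ℕ} (hp : 3 ≤ p) (heven : Even p) (hpp : p + p = n + 1)
    (hsig : μ'.signatureInDim hpp = 0) :
    ∃ (r : ℕ) (b : Module.Basis (Fin r ⊕ Fin r) ℤ (freeCohomology ℤ (ClosedModel n c.W) p)),
      Module.finrank ℤ (freeCohomology ℤ (ClosedModel n c.W) p) = 2 * r ∧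
      (∀ i j, intersectionForm hpp μ' (b (Sum.inl i)) (b (Sum.inl j)) = 0) ∧
        ∀ i j, intersectionForm hpp μ' (b (Sum.inl i)) (b (Sum.inr j)) = if i = j then 1 else 0 := by
  have hn : 1 ≤ n := by omega
  haveI : Nonempty S.carrier := S.nonempty
  have hfc : ∃ z, IsFundamentalClass μ' z :=
    ⟨_, hob.isFundamentalClass_fundamentalClass c hn⟩
  obtain ⟨hu, hfin⟩ := S.isUnimodular_intersectionForm_closedModel c hob hfc hp hpp
  haveI := hfin
  obtain ⟨hF1, hF2⟩ := finite_free_freeCohomology_of_finite (R := ℤ) (Y := ClosedModel n c.W) p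
  have hs : (intersectionForm hpp μ').IsSymm :=
    isSymm_intersectionForm (cupProduct_gradedComm_holds ℤ _) heven hpp μ'
  rw [HomologicalOrientation.signatureInDim_def] at hsig
  exact LinearMap.BilinForm.exists_basis_isotropic_dual hs hu hsig

/-! ### Lemma 7.3 as invoked on p. 530, from Lemma 7.1 and Kosinski's X.2.2 -/

/-- **Lemma 7.3 (as invoked in the proof of Thm. 7.5, p. 530) from Lemma 7.1 and X.2.2.** For
`n + 1 = 4m`, `m > 1` and a generator convention `g`: GIVEN (`h71`) **Kervaire–Milnor's
Lemma 7.1 with [17, Lemma 7] and Thm. 6.6, for s-parallelizable highly connected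
null-cobordisms** — for every homotopy `n`-sphere `Σ`, homological orientation `μ` of `Σ`,
null-cobordism `c` (`M = c.W` compact, simply connected, `Hᵢ(M; ℤ) = 0` for `0 < i < 2m`,
s-parallelizable) and orientation `μ'` of `M ∪ cone(bM)` with `(Σ, μ) = bM` whose intersection
form on `H²ᵐ(M̂; ℤ)/T` admits a basis `{λᵢ, μⱼ}` (`Fin r ⊕ Fin r`, `rank = 2r`) with
`λᵢ·λⱼ = 0`, `λᵢ·μⱼ = δᵢⱼ`, the same `Σ` bounds a simply connected `M₁` with `Hᵢ(M₁; ℤ) = 0`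
for `0 < i ≤ 2m` (pp. 526–529: "Thus `M` satisfies the hypothesis of 7.1 [the normal bundles
being trivial by [17, Lemma 7], `M` being s-parallelizable]. It follows that `HₖM` can be
killed", framed by Lemma 6.2, and Thm. 6.6 p. 526 with `bM₁ = bM` p. 514; Kosinski X.3.4) —
and (`hconn`) the named fact `exists_highlyConnected_of_mem_signatureSet` (Kosinski X.2.2 with
X.3.3; Kervaire–Milnor Thm. 5.5), **`0 ∈ signatureSet g m h Σ` implies that `Σ` bounds a
contractible manifold**: realise `σ = 0` by highly connected oriented data (`hconn`), choose the
basis (`exists_basis_isotropic_dual_intersectionForm_closedModel`, move 1 of p. 529), kill `H₂ₘ`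
(`h71`), and conclude by the last clause of Thm. 6.6
(`boundsContractible_of_isZero_singularHomology_le`).
[cite: KervaireMilnorAnnals1963, Lemma 7.3 (proof p. 529) with Lemma 7.1 (pp. 526–528), Thm. 5.5 (p. 514), Thm. 6.6 (p. 526) and p. 530] [cite: Kosinski1993, Ch. X, Thm. (2.2), Thm. (3.4), Cor. (3.6)] -/
theorem boundsContractible_of_zero_mem_signatureSet_of_lemma71 {m : ℕ} {h : n + 1 = 4 * m}
    (hm : 1 < m) {g : HomologicalOrientation ℤ (EuclideanSpace ℝ (Fin n)) n}
    (h71 : ∀ (S : HomotopySphere n) (c : NullCobordism n S.carrier)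
      (μ : HomologicalOrientation ℤ S.carrier n)
      (μ' : HomologicalOrientation ℤ (ClosedModel n c.W) (n + 1)),
      SimplyConnectedSpace c.W →
      (∀ i : ℕ, 0 < i → i < 2 * m → Subsingleton (singularHomology ℤ ℤ c.W i)) →
      IsStablyParallelizable (𝓡∂ (n + 1)) c.W → c.IsOrientedBy μ μ' →
      (∃ (r : ℕ) (b : Module.Basis (Fin r ⊕ Fin r) ℤ
          (freeCohomology ℤ (ClosedModel n c.W) (2 * m))),
        Module.finrank ℤ (freeCohomology ℤ (ClosedModel n c.W) (2 * m)) = 2 * r ∧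
        (∀ i j, intersectionForm (show 2 * m + 2 * m = n + 1 by omega) μ'
          (b (Sum.inl i)) (b (Sum.inl j)) = 0) ∧
        ∀ i j, intersectionForm (show 2 * m + 2 * m = n + 1 by omega) μ'
          (b (Sum.inl i)) (b (Sum.inr j)) = if i = j then 1 else 0) →
        ∃ c₁ : NullCobordism n S.carrier, SimplyConnectedSpace c₁.W ∧
          ∀ i : ℕ, 0 < i → i ≤ 2 * m → Subsingleton (singularHomology ℤ ℤ c₁.W i))
    (hconn : exists_highlyConnected_of_mem_signatureSet)
    (S : HomotopySphere n) (h0 : (0 : ℤ) ∈ signatureSet g m h S) :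
    BoundsContractible n S.carrier := by
  obtain ⟨μ, c, μ', hsc, hH, -, hspar, hob, hsig⟩ := hconn n m h hm g S 0 h0
  have hk : 2 * m + 2 * m = n + 1 := by omega
  obtain ⟨r, b, hr, hiso, hdual⟩ :=
    exists_basis_isotropic_dual_intersectionForm_closedModel S c hob (p := 2 * m) (by omega)
      ⟨m, two_mul m⟩ hk hsig
  obtain ⟨c₁, hsc₁, hH₁⟩ := h71 S c μ μ' hsc hH hspar hob ⟨r, b, hr, hiso, hdual⟩
  haveI := hsc₁
  exact boundsContractible_of_isZero_singularHomology_le (k := 2 * m) (by omega) (by omega) S c₁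
    fun i hi hik => by
      haveI := hH₁ i hi hik
      exact ModuleCat.isZero_of_subsingleton _

/-! ### Thm. 7.5 over Lemma 7.1, X.2.2 and the h-cobordism theorem -/

/-- **Kervaire–Milnor Thm. 7.5 from Lemma 7.1, Kosinski's X.2.2 and Smale's h-cobordism
theorem; the algebra of Lemma 7.3 and §2-additivity discharged.** The named fact
`mk_eq_mk_iff_sigmaGen_dvd_sub` (Thm. 7.5, pp. 529–530) GIVEN: (`h71`) for all `n + 1 = 4m`,
`m > 1`, **Lemma 7.1 with [17, Lemma 7] and Thm. 6.6** — a homotopy `n`-sphere `Σ = bM` with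
`M = c.W` compact, simply connected, `Hᵢ(M; ℤ) = 0` for `0 < i < 2m`, s-parallelizable, oriented
by `μ'` with `(Σ, μ) = bM`, whose intersection form on `H²ᵐ(M̂; ℤ)/T` has a basis `{λᵢ, μⱼ}`
with `λᵢ·λⱼ = 0`, `λᵢ·μⱼ = δᵢⱼ`, also bounds a simply connected `M₁` with `Hᵢ(M₁; ℤ) = 0` for
`0 < i ≤ 2m` (pp. 526–529; Kosinski X.3.4 — framed surgery ON the middle dimension, not in the
tree); (`hconn`) the named fact `exists_highlyConnected_of_mem_signatureSet` (Kosinski X.2.2,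
X.3.3; Kervaire–Milnor Thm. 5.5); (`hcob`) the named fact
`nonempty_diffeomorph_of_isHCobordant_of_five_le` (Smale; Remark p. 505). The other printed
inputs are theorems: unimodularity and the basis (move 1, p. 529:
`exists_basis_isotropic_dual_intersectionForm_closedModel`), the last clause of Thm. 6.6
(`NullCobordism.contractibleSpace_of_isZero_singularHomology_le`), Lemma 2.3, Thm. 1.1's group
laws, and §2-additivity (`add_mem_signatureSet_of_isOrientedConnectedSum_holds`). Assembly:
`mk_eq_mk_iff_sigmaGen_dvd_sub_of_boundsContractible` (`HomotopySpheresSignatureReduction.lean`)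
with `boundsContractible_of_zero_mem_signatureSet_of_lemma71`. So
`mk_eq_mk_iff_sigmaGen_dvd_sub_holds` is `mk_eq_mk_iff_sigmaGen_dvd_sub_of_lemma71 L71 hconn_holds
hcob_holds` once Lemma 7.1 (`L71`) and the two discharges exist.
[cite: KervaireMilnorAnnals1963, Thm. 7.5 (pp. 529–530), with Lemma 7.1 (pp. 526–528), Lemma 7.3 (pp. 528–529), Thm. 5.5 (p. 514), Thm. 6.6 (p. 526)] [cite: Kosinski1993, Ch. X, Thm. (2.2), Thm. (3.4), Cor. (3.6)] [cite: MilnorHCobordism1965, Thm. 9.1] -/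
theorem mk_eq_mk_iff_sigmaGen_dvd_sub_of_lemma71
    (h71 : ∀ (n m : ℕ) (h : n + 1 = 4 * m), 1 < m →
      ∀ (S : HomotopySphere n) (c : NullCobordism n S.carrier)
        (μ : HomologicalOrientation ℤ S.carrier n)
        (μ' : HomologicalOrientation ℤ (ClosedModel n c.W) (n + 1)),
        SimplyConnectedSpace c.W →
        (∀ i : ℕ, 0 < i → i < 2 * m → Subsingleton (singularHomology ℤ ℤ c.W i)) →
        IsStablyParallelizable (𝓡∂ (n + 1)) c.W → c.IsOrientedBy μ μ' →
        (∃ (r : ℕ) (b : Module.Basis (Fin r ⊕ Fin r) ℤ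
            (freeCohomology ℤ (ClosedModel n c.W) (2 * m))),
          Module.finrank ℤ (freeCohomology ℤ (ClosedModel n c.W) (2 * m)) = 2 * r ∧
          (∀ i j, intersectionForm (show 2 * m + 2 * m = n + 1 by omega) μ'
            (b (Sum.inl i)) (b (Sum.inl j)) = 0) ∧
          ∀ i j, intersectionForm (show 2 * m + 2 * m = n + 1 by omega) μ'
            (b (Sum.inl i)) (b (Sum.inr j)) = if i = j then 1 else 0) →
          ∃ c₁ : NullCobordism n S.carrier, SimplyConnectedSpace c₁.W ∧
            ∀ i : ℕ, 0 < i → i ≤ 2 * m → Subsingleton (singularHomology ℤ ℤ c₁.W i))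
    (hconn : exists_highlyConnected_of_mem_signatureSet)
    (hcob : FourManifolds.nonempty_diffeomorph_of_isHCobordant_of_five_le.{0}) :
    mk_eq_mk_iff_sigmaGen_dvd_sub :=
  mk_eq_mk_iff_sigmaGen_dvd_sub_of_boundsContractible
    (fun n m h hm _ S h0 =>
      boundsContractible_of_zero_mem_signatureSet_of_lemma71 (h := h) hm (h71 n m h hm) hconn S h0)
    hcob add_mem_signatureSet_of_isOrientedConnectedSum_holds

end HomotopySphere

/-! ### Cor. 7.6 and the cone target `Θ₇` over the same frontier -/

namespace HomotopySphereClass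

open HomotopySphere

/-- **Kervaire–Milnor Cor. 7.6 (`bP₄ₘ` finite cyclic, `m > 1`) from Lemma 7.4 (`m > 1`),
Lemma 7.1, Kosinski's X.2.2 and the h-cobordism theorem** — the named fact `isCyclic_bP_four_mul`
over the frontier of `HomotopySphere.mk_eq_mk_iff_sigmaGen_dvd_sub_of_lemma71`: (`h74`) Lemma 7.4
in the dimensions `4m - 1`, `m > 1` (a non-zero signature occurs for the standard sphere);
(`h71`) Lemma 7.1 with [17, Lemma 7] and Thm. 6.6 for s-parallelizable `(2m-1)`-connected
oriented null-cobordisms whose closed-model form has a Kervaire–Milnor basis; (`hconn`) X.2.2;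
(`hcob`) Smale. Assembly: `isCyclic_bP_four_mul_of_thm75` (`HomotopySpheresBPCyclicFrontier.lean`).
[cite: KervaireMilnorAnnals1963, Cor. 7.6 (p. 530), with Thm. 7.5, Lemma 7.1 (pp. 526–528), Lemma 7.3 (p. 529), Lemma 7.4 (p. 529), Thm. 6.6 (p. 526)] [cite: Kosinski1993, Ch. X, Thm. (2.2) and Thm. (3.4)] [cite: MilnorHCobordism1965, Thm. 9.1] -/
theorem isCyclic_bP_four_mul_of_lemma71
    (h74 : ∀ (n m : ℕ) (h : n + 1 = 4 * m), 1 < m →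
      ∀ g : HomologicalOrientation ℤ (EuclideanSpace ℝ (Fin n)) n,
        ∃ (o : SmoothOrientation (𝓡 n) (Metric.sphere (0 : EuclideanSpace ℝ (Fin (n + 1))) 1))
          (σ : ℤ),
        σ ∈ signatureSet g m h ⟨Metric.sphere (0 : EuclideanSpace ℝ (Fin (n + 1))) 1, o, ⟨.refl _⟩⟩
          ∧ σ ≠ 0)
    (h71 : ∀ (n m : ℕ) (h : n + 1 = 4 * m), 1 < m →
      ∀ (S : HomotopySphere n) (c : NullCobordism n S.carrier)
        (μ : HomologicalOrientation ℤ S.carrier n)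
        (μ' : HomologicalOrientation ℤ (ClosedModel n c.W) (n + 1)),
        SimplyConnectedSpace c.W →
        (∀ i : ℕ, 0 < i → i < 2 * m → Subsingleton (singularHomology ℤ ℤ c.W i)) →
        IsStablyParallelizable (𝓡∂ (n + 1)) c.W → c.IsOrientedBy μ μ' →
        (∃ (r : ℕ) (b : Module.Basis (Fin r ⊕ Fin r) ℤ
            (freeCohomology ℤ (ClosedModel n c.W) (2 * m))),
          Module.finrank ℤ (freeCohomology ℤ (ClosedModel n c.W) (2 * m)) = 2 * r ∧
          (∀ i j, intersectionForm (show 2 * m + 2 * m = n + 1 by omega) μ'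
            (b (Sum.inl i)) (b (Sum.inl j)) = 0) ∧
          ∀ i j, intersectionForm (show 2 * m + 2 * m = n + 1 by omega) μ'
            (b (Sum.inl i)) (b (Sum.inr j)) = if i = j then 1 else 0) →
          ∃ c₁ : NullCobordism n S.carrier, SimplyConnectedSpace c₁.W ∧
            ∀ i : ℕ, 0 < i → i ≤ 2 * m → Subsingleton (singularHomology ℤ ℤ c₁.W i))
    (hconn : exists_highlyConnected_of_mem_signatureSet)
    (hcob : FourManifolds.nonempty_diffeomorph_of_isHCobordant_of_five_le.{0}) :
    isCyclic_bP_four_mul :=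
  isCyclic_bP_four_mul_of_thm75 h74 (mk_eq_mk_iff_sigmaGen_dvd_sub_of_lemma71 h71 hconn hcob)

end HomotopySphereClass

/-- **`Θ₇` is a cyclic group under connected sum, from Lemma 7.1 at `n = 7`, Kosinski's X.2.2,
Smale's h-cobordism theorem, Lemma 3.4 "⇒" and `Θ₇ = bP₈`.** The cone target
`Literature.Topology.FourManifolds.exists_commGroup_homotopySphereClass_isCyclic_seven` GIVEN:
(`h71`) Kervaire–Milnor's Lemma 7.1 with [17, Lemma 7] and Thm. 6.6 at `n = 7`, `m = 2` — a
homotopy `7`-sphere `Σ = bM` with `M` compact, simply connected, `Hᵢ(M; ℤ) = 0` for `0 < i < 4`,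
s-parallelizable, oriented with `(Σ, μ) = bM`, whose intersection form on `H⁴(M̂; ℤ)/T` has a
Kervaire–Milnor basis, also bounds a simply connected `M₁` with `Hᵢ(M₁; ℤ) = 0` for `0 < i ≤ 4`;
(`hconn`) the named fact `HomotopySphere.exists_highlyConnected_of_mem_signatureSet`; (`hcob`)
the named fact `nonempty_diffeomorph_of_isHCobordant_of_five_le`; (`hne`) Lemma 3.4 "⇒"
(`HomotopySphere.nonempty_signatureSet_of_boundsParallelizable`); (`hB`) `Θ₇ = bP₈`
(`HomotopySphere.boundsParallelizable_seven`). §2-additivity is the theorem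
`add_mem_signatureSet_of_isOrientedConnectedSum_holds`. Assembly:
`exists_commGroup_homotopySphereClass_isCyclic_seven_of_boundsContractible`
(`HomotopySpheresSignatureReduction.lean`) with
`HomotopySphere.boundsContractible_of_zero_mem_signatureSet_of_lemma71`.
[cite: KervaireMilnorAnnals1963, Cor. 7.6 (p. 530, first sentence) at m = 2, with Thm. 7.5, Lemma 7.1 (pp. 526–528), Lemma 7.3 (p. 529), Thm. 6.6 (p. 526), §4 table p. 512] [cite: Kosinski1993, Ch. X, Thm. (2.2), Thm. (3.4)] -/
theorem exists_commGroup_homotopySphereClass_isCyclic_seven_of_lemma71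
    (h71 : ∀ (S : HomotopySphere 7) (c : NullCobordism 7 S.carrier)
      (μ : HomologicalOrientation ℤ S.carrier 7)
      (μ' : HomologicalOrientation ℤ (ClosedModel 7 c.W) (7 + 1)),
      SimplyConnectedSpace c.W →
      (∀ i : ℕ, 0 < i → i < 2 * 2 → Subsingleton (singularHomology ℤ ℤ c.W i)) →
      IsStablyParallelizable (𝓡∂ (7 + 1)) c.W → c.IsOrientedBy μ μ' →
      (∃ (r : ℕ) (b : Module.Basis (Fin r ⊕ Fin r) ℤ (freeCohomology ℤ (ClosedModel 7 c.W) (2 * 2))),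
        Module.finrank ℤ (freeCohomology ℤ (ClosedModel 7 c.W) (2 * 2)) = 2 * r ∧
        (∀ i j, intersectionForm (show 2 * 2 + 2 * 2 = 7 + 1 by norm_num) μ'
          (b (Sum.inl i)) (b (Sum.inl j)) = 0) ∧
        ∀ i j, intersectionForm (show 2 * 2 + 2 * 2 = 7 + 1 by norm_num) μ'
          (b (Sum.inl i)) (b (Sum.inr j)) = if i = j then 1 else 0) →
        ∃ c₁ : NullCobordism 7 S.carrier, SimplyConnectedSpace c₁.W ∧
          ∀ i : ℕ, 0 < i → i ≤ 2 * 2 → Subsingleton (singularHomology ℤ ℤ c₁.W i))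
    (hconn : HomotopySphere.exists_highlyConnected_of_mem_signatureSet)
    (hcob : FourManifolds.nonempty_diffeomorph_of_isHCobordant_of_five_le.{0})
    (hne : HomotopySphere.nonempty_signatureSet_of_boundsParallelizable)
    (hB : HomotopySphere.boundsParallelizable_seven) :
    exists_commGroup_homotopySphereClass_isCyclic_seven :=
  exists_commGroup_homotopySphereClass_isCyclic_seven_of_boundsContractible
    (fun _ h S h0 =>
      HomotopySphere.boundsContractible_of_zero_mem_signatureSet_of_lemma71 (h := h) (by norm_num)
        h71 hconn S h0)
    hcob HomotopySphere.add_mem_signatureSet_of_isOrientedConnectedSum_holds hne hB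

end Literature.Topology.FourManifolds

end
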